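import Literature.NumberTheory.Automorphic.UnitaryGroupAdelicOneTorusDictionary
import Literature.NumberTheory.Automorphic.UnitaryGroupArchCenter
import HarnessLib

/-!
# The archimedean torus `U(1)(F ⊗ ℝ) →* U(1)(𝔸_F)` in the `UnitaryGroup.adelicOne` currency

For a quadratic extension `E/F` of number fields with non-trivial automorphism `c`, the archimedean
relative-norm-one units `relNormOneInfUnits F E = U(1)_{E/F}(F ⊗ ℝ) ≤ (E ⊗ ℝ)ˣ` map into the adelic points
`U(1)(𝔸_F)` by `y ↦ (y, 1)` (archimedean component `y`, finite component `1`) — the archimedean component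
inclusion `G_∞ → G(𝔸_F)` of Borel–Jacquet §4.1 for `G = U(1)_{E/F}`.  The tree holds this map in the IDELE
currency (`relNormOneInfToIdeles F E : relNormOneInfUnits F E →* relNormOneIdeles F E`, `RelNormOneTorusArch`)
and the identification of currencies `adelicOneEquivRelNormOne : adelicOne F E c ≃* relNormOneIdeles F E`
(`UnitaryGroupAdelicOneTorus`); their composite — the element `(adelicOneEquivRelNormOne …).symm
(relNormOneInfToIdeles F E y)` — is displayed LONGHAND at three junctions of the tree
(`archToAdelic_archCenter` ∕ `archToAdelic_cmArchCenter` in `UnitaryGroupArchCenter`,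
`archIsotropyToAdelic_cmArchCenterIsotropy` in `UnitaryGroupArchIsotropyCenter`, and the archimedean-type
lemmas of `UnitaryGroupAdelicCharactersArchType`), and in the CM case it is the body of
`Liu2021.Def411WeilCarriersDoubling.archUnit ∕ archUnitHom` (`Liu2021/Def411WeilCarriersCentralTypeRigidity`).

This leaf names it ONCE, for general `(F, E, c)`:

* `archUnitHom F E c h2 hc : relNormOneInfUnits F E →* adelicOne F E c` — `y ↦ (y, 1)`; `archUnitHom_apply` is the
  `rfl`-bridge to the longhand element, `coe_archUnitHom` ∕ `coe_coe_archUnitHom` its underlying idele ∕ adele,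
  `adelicOneEquivRelNormOne_archUnitHom` the round trip, `archUnitHom_injective`, `continuous_archUnitHom`
  (through `continuous_adelicOneEquivRelNormOne_symm` of `UnitaryGroupAdelicOneTorusDictionary` §5),
  `coe_adelicOneEquivTorus_archUnitHom` (the same idele in the `TorusDict.torus c` currency);
* `archToAdelic_archCenter_eq_adelicCenter_archUnitHom` — **`(y · 1_N, 1) = (y, 1) · 1_N`** in `U(J)(𝔸_F)`, i.e.
  `archToAdelic_archCenter` with its right-hand side read through `archUnitHom`;
* the CM specialisations (`F = L⁺`, `c` = complex conjugation): `cmArchUnitHom L`, `cmArchUnitHom_eq` (it IS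
  `archUnitHom` at the CM data), `cmArchUnitHom_apply` (the `rfl`-bridge to
  `(cmAdelicOneEquivRelNormOne L).symm (relNormOneInfToIdeles L⁺ L y)` — hence, by `rfl`, to
  `Liu2021.Def411WeilCarriersDoubling.archUnit L y` and `archUnitHom L`, which this file does NOT import),
  `coe_cmArchUnitHom`, `cmAdelicOneEquivRelNormOne_cmArchUnitHom`, `cmArchUnitHom_injective`,
  `continuous_cmArchUnitHom`, `archToAdelic_cmArchCenter_eq_adelicCenter_cmArchUnitHom`.

Design: a NEW leaf (the junction file `UnitaryGroupAdelicOneTorusDictionary` is at its 400-line budget); imports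
are the junction file (continuity of the currency identification) and `UnitaryGroupArchCenter` (the centre
junction) only.  Deliberately NOT here: the `U(2,1)` isotropy form of the junction (it is
`archToAdelic_cmArchCenter L 3 H y`, `UnitaryGroupArchIsotropyCenter`, re-read through `cmArchUnitHom_apply`);
archimedean TYPES of characters restricted along this torus (`UnitaryLineArchExponents`,
`UnitaryGroupAdelicCharactersArchType`, `Liu2021/Def411WeilCarriersCentralTypeRigidity` §2).

References: A. Borel, H. Jacquet, *Automorphic forms and automorphic representations*, Proc. Sympos. Pure
Math. 33 (1979), part 1, §4.1 (`G(𝔸) = G_∞ × G(𝔸_f)`); V. Platonov, A. Rapinchuk, *Algebraic groups and number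
theory* (1994), §6.2 (the norm-one torus); S. Gelbart, J. Rogawski, *L-functions and Fourier–Jacobi coefficients
for the unitary group U(3)*, Invent. Math. 105 (1991), §3.1 Remark p. 457 (the archimedean torus `E¹_∞` in the
splitting-character bookkeeping).  KERNEL ONLY: 0 records, 0 named facts, 0 sorry; two plumbing definitions with
bodies.  Model-construction cell pub-hodgecm (GR-2 junction lane).
-/

set_option autoImplicit false

noncomputable section

open NumberField
open Literature.NumberTheory.GaloisRepresentations

namespace Literature.NumberTheory.Automorphic

namespace UnitaryGroup

section Quadratic

variable (F E : Type) [Field F] [NumberField F] [Field E] [NumberField E] [Algebra F E] (c : E ≃ₐ[F] E)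

/-- **the archimedean torus in `U(1)(𝔸_F)`**: `y ↦ (y, 1)`, `U(1)_{E/F}(F ⊗ ℝ) →* U(1)(𝔸_F)` in the
`UnitaryGroup.adelicOne` currency — the idele-currency map `relNormOneInfToIdeles` followed by the inverse
currency identification `(adelicOneEquivRelNormOne F E c h2 hc).symm`. [cite: BorelJacquet1979, §4.1] -/
def archUnitHom (h2 : Module.finrank F E = 2) (hc : c ≠ 1) : relNormOneInfUnits F E →* adelicOne F E c :=
  (adelicOneEquivRelNormOne F E c h2 hc).symm.toMonoidHom.comp (relNormOneInfToIdeles F E)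

/-- `rfl`-bridge to the longhand element displayed in `UnitaryGroupArchCenter` ∕
`UnitaryGroupAdelicCharactersArchType`. [cite: BorelJacquet1979, §4.1] -/
theorem archUnitHom_apply (h2 : Module.finrank F E = 2) (hc : c ≠ 1) (y : relNormOneInfUnits F E) :
    archUnitHom F E c h2 hc y = (adelicOneEquivRelNormOne F E c h2 hc).symm (relNormOneInfToIdeles F E y) :=
  rfl

/-- underlying idele of `archUnitHom y`: the archimedean idele `(y, 1)`. [cite: BorelJacquet1979, §4.1] -/
@[simp] theorem coe_archUnitHom (h2 : Module.finrank F E = 2) (hc : c ≠ 1) (y : relNormOneInfUnits F E) :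
    ((archUnitHom F E c h2 hc y : adelicOne F E c) : ideleGroup E) = infiniteIdeles E (y : (InfiniteAdeleRing E)ˣ) :=
  rfl

/-- underlying adele of `archUnitHom y`: `(↑y, 1) ∈ E_∞ × 𝔸_{E,f}`. [cite: BorelJacquet1979, §4.1] -/
theorem coe_coe_archUnitHom (h2 : Module.finrank F E = 2) (hc : c ≠ 1) (y : relNormOneInfUnits F E) :
    (((archUnitHom F E c h2 hc y : adelicOne F E c) : ideleGroup E) : AdeleRing (𝓞 E) E) =
      (((y : (InfiniteAdeleRing E)ˣ) : InfiniteAdeleRing E), (1 : IsDedekindDomain.FiniteAdeleRing (𝓞 E) E)) :=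
  rfl

/-- round trip: `archUnitHom y` read back in the idele currency is `relNormOneInfToIdeles y` (the projection
`G(𝔸_F) → G_∞` retracts the inclusion of the archimedean factor of `G(𝔸_F) = G_∞ × G(𝔸_{F,f})`).
[cite: BorelJacquet1979, §4.1] -/
@[simp] theorem adelicOneEquivRelNormOne_archUnitHom (h2 : Module.finrank F E = 2) (hc : c ≠ 1)
    (y : relNormOneInfUnits F E) :
    adelicOneEquivRelNormOne F E c h2 hc (archUnitHom F E c h2 hc y) = relNormOneInfToIdeles F E y :=
  MulEquiv.apply_symm_apply _ _

/-- the same idele in the `TorusDict.torus c` currency of the torus dictionary. [cite: PlatonovRapinchuk1994, §6.2] -/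
@[simp] theorem coe_adelicOneEquivTorus_archUnitHom (h2 : Module.finrank F E = 2) (hc : c ≠ 1)
    (y : relNormOneInfUnits F E) :
    ((adelicOneEquivTorus F E c (archUnitHom F E c h2 hc y) : Arthur2013.Leaves.TECR.TorusDict.torus c) : ideleGroup E) =
      infiniteIdeles E (y : (InfiniteAdeleRing E)ˣ) :=
  rfl

/-- `y ↦ (y, 1)` is injective (inclusion of the direct factor `G_∞` of `G(𝔸_F) = G_∞ × G(𝔸_{F,f})`).
[cite: BorelJacquet1979, §4.1] -/
theorem archUnitHom_injective (h2 : Module.finrank F E = 2) (hc : c ≠ 1) :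
    Function.Injective (archUnitHom F E c h2 hc) :=
  (adelicOneEquivRelNormOne F E c h2 hc).symm.injective.comp (relNormOneInfToIdeles_injective F E)

/-- `y ↦ (y, 1)` is continuous (subspace topologies of `(E ⊗ ℝ)ˣ` and `𝕀_E`). [cite: BorelJacquet1979, §4.1] -/
theorem continuous_archUnitHom (h2 : Module.finrank F E = 2) (hc : c ≠ 1) : Continuous (archUnitHom F E c h2 hc) :=
  (continuous_adelicOneEquivRelNormOne_symm F E c h2 hc).comp (continuous_relNormOneInfToIdeles F E)

variable (N : ℕ) (J : Matrix (Fin N) (Fin N) E)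

/-- **`(y · 1_N, 1) = (y, 1) · 1_N` in `U(J)(𝔸_F)`**: the archimedean component of the archimedean central element
`y · 1_N` is the adelic central element of `archUnitHom y` (`archToAdelic_archCenter`, right-hand side read through
`archUnitHom`). [cite: BorelJacquet1979, §4.1] -/
theorem archToAdelic_archCenter_eq_adelicCenter_archUnitHom (h2 : Module.finrank F E = 2) (hc : c ≠ 1)
    (y : relNormOneInfUnits F E) :
    archToAdelic F E c N J (archCenter F E c N J h2 hc y) = adelicCenter F E c N J (archUnitHom F E c h2 hc y) :=
  archToAdelic_archCenter F E c N J h2 hc y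

end Quadratic

section CM

variable (L : Type) [Field L] [NumberField L] [IsCMField L]

/-- **the CM archimedean torus** `U(1)(L⁺ ⊗ ℝ) →* U(1)(𝔸_{L⁺})`, `y ↦ (y, 1)` (`F = L⁺`, `c` = complex
conjugation). [cite: BorelJacquet1979, §4.1] -/
def cmArchUnitHom :
    relNormOneInfUnits (↥(maximalRealSubfield L)) L →* adelicOne (↥(maximalRealSubfield L)) L (IsCMField.complexConj L) :=
  archUnitHom _ L _ (Algebra.IsQuadraticExtension.finrank_eq_two _ L) (IsCMField.complexConj_ne_one (K := L))

/-- `cmArchUnitHom` is `archUnitHom` at the CM data `(L⁺, L, c)` (definitional). [cite: BorelJacquet1979, §4.1] -/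
theorem cmArchUnitHom_eq : cmArchUnitHom L =
    archUnitHom _ L _ (Algebra.IsQuadraticExtension.finrank_eq_two _ L) (IsCMField.complexConj_ne_one (K := L)) :=
  rfl

/-- `rfl`-bridge to the longhand CM element `(cmAdelicOneEquivRelNormOne L).symm (relNormOneInfToIdeles L⁺ L y)` of
`archToAdelic_cmArchCenter` ∕ `archIsotropyToAdelic_cmArchCenterIsotropy` ∕ `UnitaryGroupAdelicCharactersArchType`
(and hence to `Liu2021.Def411WeilCarriersDoubling.archUnit L y`, whose body it is). [cite: BorelJacquet1979, §4.1] -/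
theorem cmArchUnitHom_apply (y : relNormOneInfUnits (↥(maximalRealSubfield L)) L) :
    cmArchUnitHom L y = (cmAdelicOneEquivRelNormOne L).symm (relNormOneInfToIdeles (↥(maximalRealSubfield L)) L y) :=
  rfl

/-- underlying idele of `cmArchUnitHom y`: `(y, 1)`. [cite: BorelJacquet1979, §4.1] -/
@[simp] theorem coe_cmArchUnitHom (y : relNormOneInfUnits (↥(maximalRealSubfield L)) L) :
    ((cmArchUnitHom L y : adelicOne (↥(maximalRealSubfield L)) L (IsCMField.complexConj L)) : ideleGroup L) =
      infiniteIdeles L (y : (InfiniteAdeleRing L)ˣ) :=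
  rfl

/-- round trip in the CM case (the projection to the archimedean factor retracts `y ↦ (y, 1)`).
[cite: BorelJacquet1979, §4.1] -/
@[simp] theorem cmAdelicOneEquivRelNormOne_cmArchUnitHom (y : relNormOneInfUnits (↥(maximalRealSubfield L)) L) :
    cmAdelicOneEquivRelNormOne L (cmArchUnitHom L y) = relNormOneInfToIdeles (↥(maximalRealSubfield L)) L y :=
  MulEquiv.apply_symm_apply _ _

/-- `cmArchUnitHom` is injective (inclusion of the archimedean factor). [cite: BorelJacquet1979, §4.1] -/
theorem cmArchUnitHom_injective : Function.Injective (cmArchUnitHom L) :=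
  archUnitHom_injective _ L _ _ _

/-- `cmArchUnitHom` is continuous. [cite: BorelJacquet1979, §4.1] -/
theorem continuous_cmArchUnitHom : Continuous (cmArchUnitHom L) :=
  continuous_archUnitHom _ L _ _ _

variable (N : ℕ) (H : Matrix (Fin N) (Fin N) L)

/-- **CM junction `(y · 1_N, 1) = (y, 1) · 1_N`** read through `cmArchUnitHom` (`archToAdelic_cmArchCenter`).
[cite: BorelJacquet1979, §4.1] -/
theorem archToAdelic_cmArchCenter_eq_adelicCenter_cmArchUnitHom (y : relNormOneInfUnits (↥(maximalRealSubfield L)) L) :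
    archToAdelic _ L (IsCMField.complexConj L) N H (cmArchCenter L N H y) =
      adelicCenter _ L (IsCMField.complexConj L) N H (cmArchUnitHom L y) :=
  archToAdelic_cmArchCenter L N H y

end CM

end UnitaryGroup

end Literature.NumberTheory.Automorphic

end
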